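import Summits.QuantumFields.YangMills.Theorems.BalabanUVNodesN11Sect3SupplyDefs
import Literature.MathematicalPhysics.QuantumFieldTheory.Balaban1983to89.B14SeparationOfRecord
import Literature.MathematicalPhysics.QuantumFieldTheory.Balaban1983to89.B16RLeafRecord11

/-!
# DAG node N11 — [III] §3's SUPPLY IS NEEDED ONLY AT THE EXPANSION SEQUENCES WITH A PRESENT PARENT: if `ρ_k(init s′) ≡ 0` (an absent ∕ dead parent — e.g. `init s′` off the
# range of the level-`k` selector) then `𝐓ρ_k(s′) ≡ 0` and the 𝐓-image clause at `s′` holds by its zero disjunct; so `Sect3SupplyAt θ p k` follows from a supply that serves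
# the clause only where `ρ_k(init s′) ≢ 0` (laws everywhere)

Cell `pub-ymgap`, YM-PLAN Track A (HUMAN RULING D-0062), seat `pub-ymgap-dag-n11-e` (g14; R134 fan-out row N11∕s3), route `BalabanUVNodes` rev 25 (v1.7 `CoPH` key), item K1⁷
`StabilityBAtRecordR13SepCoPH` = stmt-QuantumFields-20542 (helper lane, count-neutral).  [III] = [Balaban1988Convergent], [IV] = [Balaban1989LargeFieldI].  Over this seat's
`…Sect3SupplyDefs` (g14, `Sect3SupplyAt`), `…B14SeparationOfRecord` (`slotsTOfRecord_succ_eq_zero_of_init_eq_zero`: an absent parent has absent children, pre-𝐑) and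
`…B16RLeafRecord11` (n13-c's empty-fibre algebra `rstepSlotOfRecord_of_not_mem_range`).

WHY THIS FILE.  `Sect3SupplyAt θ p k` (this seat's `…Sect3SupplyDefs`) asks [III] §3's 𝐓-image clause at EVERY expansion sequence `s′` (`Ω_{k+1}(s′) ≠ ∅`).  But the 𝐓-image
slot at `s′` is the kernel transport of `w(s′)·χ_k(init s′)·ρ_k(init s′)` ((3.24)–(3.25); def-T's `slotsTOfRecord_succ`), so it VANISHES IDENTICALLY whenever the parent slot
`ρ_k(init s′)` does — in particular whenever `init s′` lies off the range of the level-`k` selector (the (0.3) fibre is empty: n13-c's algebra), e.g. at every history that 𝐑 of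
record has already resummed onto another one.  There the clause holds by its ZERO DISJUNCT, whatever candidate terms are offered.  HENCE the supplier's genuine burden is the set
of expansion children of PRESENT parents; this file records the reduction so that a §3 supplier (or a refuter) reads the exact target:
§1 `slotsOfRecord₁₃H_succ_eq_zero_of_not_mem_range` (Stage-13 `H` twin of `…B16RLeafRecord12.slotsOfRecord₁₂_succ_eq_zero_of_not_mem_range`: off the range of
   `θ.ppSel p g (k+1)` the post-𝐑 slot of `ρ_{k+1}` is the zero function) · `slotsTOfRecord₁₃H_succ_eq_zero_of_init_eq_zero` (absent parent ⇒ absent 𝐓-image child).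
§2 ★ `sect3SupplyAt_of_supply_at_present_parents` — `Sect3SupplyAt θ p k` from a supply whose clause is asked only at the expansion sequences with `ρ_k(init s′) ≢ 0`
   (laws `Sect2.LawsT … k` still at every expansion sequence; bookkeeping at the no-expansion ones unchanged).
§3 ★ `sect3SupplyAt_succ_of_supply_at_selected_parents` — at a level `k+1 ≥ 1`: the clause asked only at the expansion sequences of length `k+2` whose parent lies IN THE RANGE
   of the level-`(k+1)` selector `θ.ppSel p g (k+1)` (at node00-def-K0a's live selector: a LIVE parent).

HONEST FRAMING.  Count-neutral kernel bookkeeping (two zero lemmas and a case split); the supply at present parents is DISPLAYED, not discharged; nothing of Bałaban asserted;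
N11 NOT discharged; K1⁷ NOT closed; counts unmoved (typed 28∕28 · discharged 5∕27).  One finite `𝕋⁴_{L^K}` programme at fixed `ε = L^{−K}`; NOT ℝ⁴, NOT OS, NOT a mass gap,
NOT Clay.
Sources: [III] (3.1) p.264, (3.24)–(3.25) p.270, (2.17)–(2.18) p.257, §3 p.279; [IV] (0.3) p.176.
-/

noncomputable section

open MeasureTheory
open scoped BigOperators Matrix.Norms.L2Operator

namespace Summit.QuantumFields.YangMills.Theorems.BalabanUVNodesN11Sect3SupplyPresentParents

open Literature.MathematicalPhysics.QuantumFieldTheory.Balaban1983to89 T4Continuum Node00 Node00.Tk DagBinding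
open Literature.MathematicalPhysics.QuantumFieldTheory.Balaban1983to89.B14SeparationOfRecord (slotsTOfRecord_succ_eq_zero_of_init_eq_zero)
open Literature.MathematicalPhysics.QuantumFieldTheory.Balaban1983to89.B16RLeafRecord11 (rstepSlotOfRecord_of_not_mem_range)
open BalabanUVNodesN11Sect3SupplyDefs

variable {F : T4Family} {N : ℕ} [NeZero N]
variable (θ : Stage13HParams F N) (p : B12.RunParams)

/-! ## §1. Absent parents: off the selector's range the post-𝐑 slot is zero; an absent parent has an absent 𝐓-image child -/

section Absent

/-- **OFF THE RANGE OF THE LEVEL-`(k+1)` SELECTOR THE POST-𝐑 SLOT OF `ρ_{k+1}` IS THE ZERO FUNCTION** at a v1.7 parameter (def-T's `slotsOfRecord_succ` + n13-c's empty-fibre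
algebra `rstepSlotOfRecord_of_not_mem_range`; the Stage-13 `H` twin of `…B16RLeafRecord12.slotsOfRecord₁₂_succ_eq_zero_of_not_mem_range`). [cite: Balaban1989LargeFieldI, (0.3) p.176; Balaban1988Convergent, (2.17)–(2.18) p.257] -/
theorem slotsOfRecord₁₃H_succ_eq_zero_of_not_mem_range (k : ℕ) (s' : SeqOfRecord F θ.ν θ.τ9.M (gOfRecord₁₃ F N θ.toStage13Params p) p.K (k + 1))
    (hs' : s' ∉ Set.range (θ.ppSel p (gOfRecord₁₃ F N θ.toStage13Params p) (k + 1))) :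
    slotsOfRecord F N θ.ν θ.τ9 (EOfRecord₁₃ F N θ.toStage13Params) (wOfRecord₉ F N θ.toStage9Params) θ.ppSel p (gOfRecord₁₃ F N θ.toStage13Params p) (k + 1) s' = 0 := by
  funext V
  rw [slotsOfRecord_succ]
  exact rstepSlotOfRecord_of_not_mem_range θ.ν θ.τ9 θ.ppSel p _ (k + 1) _ s' hs' V

/-- **AN ABSENT PARENT HAS AN ABSENT 𝐓-IMAGE CHILD** at a v1.7 parameter: `ρ_k(init s′) ≡ 0 ⇒ 𝐓ρ_k(s′) ≡ 0` (the transport of `w·χ·0`; this seat's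
`…B14SeparationOfRecord.slotsTOfRecord_succ_eq_zero_of_init_eq_zero` read at the record's families). [cite: Balaban1988Convergent, (3.1) p.264, (3.24)–(3.25) p.270] -/
theorem slotsTOfRecord₁₃H_succ_eq_zero_of_init_eq_zero {k : ℕ} (s' : SeqOfRecord F θ.ν θ.τ9.M (gOfRecord₁₃ F N θ.toStage13Params p) p.K (k + 1))
    (h0 : slotsOfRecord F N θ.ν θ.τ9 (EOfRecord₁₃ F N θ.toStage13Params) (wOfRecord₉ F N θ.toStage9Params) θ.ppSel p (gOfRecord₁₃ F N θ.toStage13Params p) k s'.init = 0) :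
    slotsTOfRecord F N θ.ν θ.τ9 (EOfRecord₁₃ F N θ.toStage13Params) (wOfRecord₉ F N θ.toStage9Params) θ.ppSel p (gOfRecord₁₃ F N θ.toStage13Params p) (k + 1) s' = 0 :=
  slotsTOfRecord_succ_eq_zero_of_init_eq_zero F N θ.ν θ.τ9 _ _ θ.ppSel p _ _ s' h0

end Absent

/-! ## §2. The supply is needed only at the expansion children of PRESENT parents -/

section Present

/-- **★ `Sect3SupplyAt θ p k` FROM A SUPPLY SERVING THE EXPANSION CHILDREN OF PRESENT PARENTS ONLY**: for every exposed witness a candidate family with the no-expansion bookkeeping,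
the 𝐓-image laws at EVERY expansion sequence, and the 𝐓-image clause at the expansion sequences `s′` with `ρ_k(init s′) ≢ 0` — at the others the clause holds by its zero
disjunct (§1). [cite: Balaban1988Convergent, Theorem p.245, §3 p.279, (3.24)–(3.25) p.270, (2.17)–(2.18) p.257] -/
theorem sect3SupplyAt_of_supply_at_present_parents (k : ℕ)
    (h : ∀ (t : SeqOfRecord F θ.ν θ.τ9.M (gOfRecord₁₃ F N θ.toStage13Params p) p.K k → Sect2.TermValues (F.P p.K) (MatA N) (FluctV N) θ.τ9.M) (Ek : SeqOfRecord F θ.ν θ.τ9.M (gOfRecord₁₃ F N θ.toStage13Params p) p.K k → ℝ),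
      HasSect2FormAtZS F N (FluctV N) p.K (settingOfRecord₁₃ F N θ.toStage13Params p) k (θ.rzAt p) (WtOfRecord₁₃H F N θ p) (UbgOfRecord₁₃CoP F N θ.toStage13Params p k)
        (fun s u => Sect2.LawsRT (sect2TowerOfRecord F N (FluctV N) p.K (settingOfRecord₁₃ F N θ.toStage13Params p) (θ.rzAt p s) s u) (settingOfRecord₁₃ F N θ.toStage13Params p).lf k)
        (slotsOfRecord F N θ.ν θ.τ9 (EOfRecord₁₃ F N θ.toStage13Params) (wOfRecord₉ F N θ.toStage9Params) θ.ppSel p (gOfRecord₁₃ F N θ.toStage13Params p) k) t Ek →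
      ∃ (tT : SeqOfRecord F θ.ν θ.τ9.M (gOfRecord₁₃ F N θ.toStage13Params p) p.K (k + 1) → Sect2.TermValues (F.P p.K) (MatA N) (FluctV N) θ.τ9.M) (EkT : SeqOfRecord F θ.ν θ.τ9.M (gOfRecord₁₃ F N θ.toStage13Params p) p.K (k + 1) → ℝ),
        Sect2.UniversalE tT ∧
        (∀ s : SeqOfRecord F θ.ν θ.τ9.M (gOfRecord₁₃ F N θ.toStage13Params p) p.K (k + 1), s.Ω (k + 1) = ∅ →
          (∀ j, j ≤ k → ∀ X z g φ, (tT s).E j X z g φ = (t s.init).E j X z g φ) ∧ (∀ j, j ≤ k → ∀ X φ, (tT s).R j X φ = (t s.init).R j X φ) ∧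
          (∀ j, j ≤ k → ∀ X φ a, (tT s).B j X φ a = (t s.init).B j X φ a) ∧
          (∀ X φ, (tT s).R (k + 1) X φ = 0) ∧ (∀ X φ a, (tT s).B (k + 1) X φ a = 0) ∧ EkT s = Ek s.init) ∧
        (∀ s : SeqOfRecord F θ.ν θ.τ9.M (gOfRecord₁₃ F N θ.toStage13Params p) p.K (k + 1), s.Ω (k + 1) ≠ ∅ →
          Sect2.LawsT (sect2TowerOfRecord F N (FluctV N) p.K (settingOfRecord₁₃ F N θ.toStage13Params p) (θ.rzAt p s) s (tT s)) (settingOfRecord₁₃ F N θ.toStage13Params p).lf (settingOfRecord₁₃ F N θ.toStage13Params p).βc k ∧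
          (slotsOfRecord F N θ.ν θ.τ9 (EOfRecord₁₃ F N θ.toStage13Params) (wOfRecord₉ F N θ.toStage9Params) θ.ppSel p (gOfRecord₁₃ F N θ.toStage13Params p) k s.init ≠ 0 →
            (slotsTOfRecord F N θ.ν θ.τ9 (EOfRecord₁₃ F N θ.toStage13Params) (wOfRecord₉ F N θ.toStage9Params) θ.ppSel p
              (gOfRecord₁₃ F N θ.toStage13Params p) (k + 1) s = 0 ∨
            ∀ᵐ V' ∂fieldMeasure (F.P p.K) (k + 1) (SU N),
              chiSeqOfRecord F N θ.ν θ.τ9.M (gOfRecord₁₃ F N θ.toStage13Params p) p.K (k + 1) s V' ≠ 0 →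
                slotsTOfRecord F N θ.ν θ.τ9 (EOfRecord₁₃ F N θ.toStage13Params) (wOfRecord₉ F N θ.toStage9Params) θ.ppSel p
                    (gOfRecord₁₃ F N θ.toStage13Params p) (k + 1) s V' =
                  sect2Slot F N (FluctV N) p.K (settingOfRecord₁₃ F N θ.toStage13Params p) (θ.rzAt p s) (WtOfRecord₁₃H F N θ p s) s (tT s) (EkT s)
                    (UbgOfRecord₁₃CoP F N θ.toStage13Params p (k + 1) s) V')))) :
    Sect3SupplyAt θ p k := by
  intro t Ek hS
  obtain ⟨tT, EkT, hu, hbk, hx⟩ := h t Ek hS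
  refine ⟨tT, EkT, hu, hbk, fun s hs => ⟨(hx s hs).1, ?_⟩⟩
  by_cases h0 : slotsOfRecord F N θ.ν θ.τ9 (EOfRecord₁₃ F N θ.toStage13Params) (wOfRecord₉ F N θ.toStage9Params) θ.ppSel p (gOfRecord₁₃ F N θ.toStage13Params p) k s.init = 0
  · exact Or.inl (slotsTOfRecord₁₃H_succ_eq_zero_of_init_eq_zero θ p s h0)
  · exact (hx s hs).2 h0

end Present

/-! ## §3. At a positive level: only the expansion children of SELECTED parents (range points of the selector) -/

section Selected

/-- **★ `Sect3SupplyAt θ p (k+1)` FROM A SUPPLY SERVING THE EXPANSION CHILDREN OF SELECTED PARENTS ONLY**: at a level `k+1 ≥ 1` the parent of a history `s′` of length `k+2` is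
PRESENT only if it lies in the range of the level-`(k+1)` selector `θ.ppSel p g (k+1)` (§1) — at node00-def-K0a's live selector: only if it is LIVE.  So the clause is asked
only there. [cite: Balaban1988Convergent, Theorem p.245, §3 p.279, (3.24)–(3.25) p.270; Balaban1989LargeFieldI, (0.3) p.176] -/
theorem sect3SupplyAt_succ_of_supply_at_selected_parents (k : ℕ)
    (h : ∀ (t : SeqOfRecord F θ.ν θ.τ9.M (gOfRecord₁₃ F N θ.toStage13Params p) p.K (k + 1) → Sect2.TermValues (F.P p.K) (MatA N) (FluctV N) θ.τ9.M) (Ek : SeqOfRecord F θ.ν θ.τ9.M (gOfRecord₁₃ F N θ.toStage13Params p) p.K (k + 1) → ℝ),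
      HasSect2FormAtZS F N (FluctV N) p.K (settingOfRecord₁₃ F N θ.toStage13Params p) (k + 1) (θ.rzAt p) (WtOfRecord₁₃H F N θ p) (UbgOfRecord₁₃CoP F N θ.toStage13Params p (k + 1))
        (fun s u => Sect2.LawsRT (sect2TowerOfRecord F N (FluctV N) p.K (settingOfRecord₁₃ F N θ.toStage13Params p) (θ.rzAt p s) s u) (settingOfRecord₁₃ F N θ.toStage13Params p).lf (k + 1))
        (slotsOfRecord F N θ.ν θ.τ9 (EOfRecord₁₃ F N θ.toStage13Params) (wOfRecord₉ F N θ.toStage9Params) θ.ppSel p (gOfRecord₁₃ F N θ.toStage13Params p) (k + 1)) t Ek →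
      ∃ (tT : SeqOfRecord F θ.ν θ.τ9.M (gOfRecord₁₃ F N θ.toStage13Params p) p.K (k + 1 + 1) → Sect2.TermValues (F.P p.K) (MatA N) (FluctV N) θ.τ9.M) (EkT : SeqOfRecord F θ.ν θ.τ9.M (gOfRecord₁₃ F N θ.toStage13Params p) p.K (k + 1 + 1) → ℝ),
        Sect2.UniversalE tT ∧
        (∀ s : SeqOfRecord F θ.ν θ.τ9.M (gOfRecord₁₃ F N θ.toStage13Params p) p.K (k + 1 + 1), s.Ω (k + 1 + 1) = ∅ →
          (∀ j, j ≤ k + 1 → ∀ X z g φ, (tT s).E j X z g φ = (t s.init).E j X z g φ) ∧ (∀ j, j ≤ k + 1 → ∀ X φ, (tT s).R j X φ = (t s.init).R j X φ) ∧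
          (∀ j, j ≤ k + 1 → ∀ X φ a, (tT s).B j X φ a = (t s.init).B j X φ a) ∧
          (∀ X φ, (tT s).R (k + 1 + 1) X φ = 0) ∧ (∀ X φ a, (tT s).B (k + 1 + 1) X φ a = 0) ∧ EkT s = Ek s.init) ∧
        (∀ s : SeqOfRecord F θ.ν θ.τ9.M (gOfRecord₁₃ F N θ.toStage13Params p) p.K (k + 1 + 1), s.Ω (k + 1 + 1) ≠ ∅ →
          Sect2.LawsT (sect2TowerOfRecord F N (FluctV N) p.K (settingOfRecord₁₃ F N θ.toStage13Params p) (θ.rzAt p s) s (tT s)) (settingOfRecord₁₃ F N θ.toStage13Params p).lf (settingOfRecord₁₃ F N θ.toStage13Params p).βc (k + 1) ∧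
         
          (s.init ∈ Set.range (θ.ppSel p (gOfRecord₁₃ F N θ.toStage13Params p) (k + 1)) → (slotsTOfRecord F N θ.ν θ.τ9 (EOfRecord₁₃ F N θ.toStage13Params) (wOfRecord₉ F N θ.toStage9Params) θ.ppSel p
              (gOfRecord₁₃ F N θ.toStage13Params p) (k + 1 + 1) s = 0 ∨
            ∀ᵐ V' ∂fieldMeasure (F.P p.K) (k + 1 + 1) (SU N),
              chiSeqOfRecord F N θ.ν θ.τ9.M (gOfRecord₁₃ F N θ.toStage13Params p) p.K (k + 1 + 1) s V' ≠ 0 →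
                slotsTOfRecord F N θ.ν θ.τ9 (EOfRecord₁₃ F N θ.toStage13Params) (wOfRecord₉ F N θ.toStage9Params) θ.ppSel p
                    (gOfRecord₁₃ F N θ.toStage13Params p) (k + 1 + 1) s V' =
                  sect2Slot F N (FluctV N) p.K (settingOfRecord₁₃ F N θ.toStage13Params p) (θ.rzAt p s) (WtOfRecord₁₃H F N θ p s) s (tT s) (EkT s)
                    (UbgOfRecord₁₃CoP F N θ.toStage13Params p (k + 1 + 1) s) V')))) :
    Sect3SupplyAt θ p (k + 1) := by
  refine sect3SupplyAt_of_supply_at_present_parents θ p (k + 1) fun t Ek hS => ?_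
  obtain ⟨tT, EkT, hu, hbk, hx⟩ := h t Ek hS
  refine ⟨tT, EkT, hu, hbk, fun s hs => ⟨(hx s hs).1, fun hne => (hx s hs).2 ?_⟩⟩
  by_contra hmem
  exact hne (slotsOfRecord₁₃H_succ_eq_zero_of_not_mem_range θ p k s.init hmem)

end Selected

end Summit.QuantumFields.YangMills.Theorems.BalabanUVNodesN11Sect3SupplyPresentParents

end
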